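import Summits.BirchSwinnertonDyer.BirchSwinnertonDyer.Theses.ErratumRoadFive
import Summits.BirchSwinnertonDyer.BirchSwinnertonDyer.Theorems.ErratumRoadFiveEulerHalfNotRamRung129360cy1Image
import Summits.BirchSwinnertonDyer.BirchSwinnertonDyer.Theorems.ErratumRoadFiveEulerHalfNotRamPAnchorResidual
import HarnessLib

/-!
# Route `ErratumRoadFive`, crux `EulerHalfNotRamNoInertSetAtFive` (item stmt-BirchSwinnertonDyer-19715), line `birth` (v13) —
# (129360cy1, 5): THE RUNG ON THE p-ANCHOR ROAD — from EXACTLY the v13 composition's binders (six route items + F(2) + LAB),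
# no typed display at the pair, no datum lemma; with the kernel image certificates, ONE per-pair input: `r_an(E) = 1`

Cell `bsd-stepL`, seat `bsd-line-er5-p1-w3` (D-0154 extra width seat on crux 19715, lead `bsd-line-er5-p1`), `--supports stmt-BirchSwinnertonDyer-19715`.
THEOREMS ONLY, ONE curve: `E = [0,1,0,−615785,185776275]` = Cremona **129360cy1** (`N = 2⁴·3·5·7²·11`). The LEAD's optional ask (HOME/STATUS
2026-08-28T11:57:34Z): restate the (129360cy1, 5) rung (this seat's `…Rung129360cy1UpToOne` p628693 ∕ `…AnalyticRank`) on the **p-ANCHOR road** of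
the registered skeleton v13 — `EulerHalfPAnchor.eulerHalfNotRam_otherMult_of_items_of_LAB` (LEAD g1 p630971, after bsd-idea-9 g4 ∕ idea-crit-14: on
every Shimura frame `p ∈ S`, Pasten L6.18 AT `q = p` gives `p ∤ κ_S(p)`, the switching lemma transports it, and the `p`-last telescope yields (DEG) for
EVERY even `S ∋ p` — no witness, no Papikian–Rabinoff half, no up-to-one datum) — so that the pair's certificate no longer cites the datum lemma. Its
per-pair inputs `Surj E 5`, `¬ Ram E 5`, «a multiplicative `ℓ ≠ 5`» are KERNEL THEOREMS of this seat's route-free files (`Rung129360cy1.surj_five`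
p630372, `not_ram_five` ∕ `exists_otherMult` p627895), and `ClassX11b E 5 ↔ E.analyticRank = 1` (`classX11b_five_iff_analyticRank`).

* `missingUpperBoundAt_of_analyticRank_of_items_of_LAB_pAnchor` — `E.analyticRank = 1 ⟹ Typed.MissingUpperBoundAt E 5`, GIVEN exactly the binders of
  `Birth.EulerHalfNotRamNoInertSetAtFive_of` in v13 that the S2 road uses: the six route items `PublishedInputsFive`, `X11aLowerHalf`,
  `ShimuraParametrizationDataNonempty`, `PastenComponentOrdersInput`, `ShimuraCasselsTateLevelInputs`, `ShimuraHeegnerEulerSystemInertPrintedR`, conjunct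
  (2) of the citable print stub (SelmerComplement of THE canonical invariant maps; a tree THEOREM since -w2 p629616, kept as a binder to match the road's
  signature), and the registered typed stub `stub_shimuraCarrierLabelsB6AtFive` (LAB = HOLE 1; TEXT VERBATIM as `hLabT`).
* `rung_res_129360cy1_of_items_of_LAB_pAnchor` — crux 19715's TEXT at `(E, 5)` VERBATIM as conclusion from the same binders (the text's own `ClassX11b` ∕
  `Surj` ∕ `¬ Ram` binders feed the road; `5 ∣ ∏c` and «no inert datum» unused).

HONEST FRAMING: CONDITIONAL on the items (OPEN: `X11aLowerHalf`; typed-not-proved: the printed inputs, `casselsTate_levelInputs`, the inert printed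
primitives, the (B6)-labelled CM family = LAB) and on `r_an(E) = 1`; a helper `--supports` 19715, not a closure; BSD(129360cy1, 5) is NOT proved by this;
nothing is booked; no summit statement is touched; no definition, no named fact, no `sorry`, no kit. Credit: the road is LEAD g1's landing of bsd-idea-9
g4's `coker_units_surj` v4 §4∕§6 (idea-crit-14 V29).

References: [PastenShimura2024] Prop. 6.13, Lemma 6.15, Lemma 6.18 (p0024–p0025); [PapikianRabinoff2016] Cor. 3.5; [Jetchev2008] Thm. 1.1, Cor. 1.5;
[Kim2022HigherGZ] Rem. 7.9; [Serre1972] §2.8 Prop. 19; [Cremona1997] Table 1 ∕ ecdata (curve 129360cy1).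
-/

noncomputable section

open scoped Classical NumberField

open WeierstrassCurve NumberField IsDedekindDomain Literature.NumberTheory.EllipticCurves
  Literature.NumberTheory.EllipticCurves.Rank1Residual
  Literature.NumberTheory.EllipticCurves.Rank1Residual.Typed
  Summit.BirchSwinnertonDyer.Rank1Residual Summit.BirchSwinnertonDyer.Rank1Residual.X11b
  Summit.BirchSwinnertonDyer.BirchSwinnertonDyer.Rank1Residual
  Summit.BirchSwinnertonDyer.BirchSwinnertonDyer.Theses.ErratumRoadFive

-- the cell's Theorems namespace repeats the summit name (Summit.<Summit>.<Problem>), as in every sibling file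
set_option linter.dupNamespace false

namespace Summit.BirchSwinnertonDyer.BirchSwinnertonDyer.Theorems.EulerHalfInertUpToOne.Rung129360cy1

/-- **`r_an(E) = 1` ⟹ `Typed.MissingUpperBoundAt E 5` for `E` = 129360cy1 ON THE p-ANCHOR ROAD**, GIVEN exactly the v13 composition's binders for piece S2
(six route items + conjunct (2) of the print stub + LAB): `EulerHalfPAnchor.eulerHalfNotRam_otherMult_of_items_of_LAB` (LEAD g1 p630971) at the pair, its
per-pair inputs supplied by kernel theorems — `ClassX11b E 5` from `r_an = 1` (`classX11b_five_iff_analyticRank`: `mult_five`, `irr_five`), `Surj E 5`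
(`surj_five`: Serre witnesses `13, 23, 23`), `¬ Ram E 5` (`not_ram_five`), a multiplicative `ℓ ≠ 5` (`exists_otherMult`: `ℓ = 3`). No typed display at the
pair, no datum lemma. CONDITIONAL on the binders; nothing booked. [cite: PastenShimura2024, Lemma 6.15, Lemma 6.18] [cite: Serre1972, §2.8 Prop. 19]
[cite: Cremona1997, Table 1 (curve 129360cy1)] -/
theorem missingUpperBoundAt_of_analyticRank_of_items_of_LAB_pAnchor (h₅ : PublishedInputsFive) (h₃ : X11aLowerHalf)
    (hJL : ShimuraParametrizationDataNonempty) (hCO : PastenComponentOrdersInput) (hCTi : ShimuraCasselsTateLevelInputs)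
    (hESi : ShimuraHeegnerEulerSystemInertPrintedR)
    (hSC : ∀ (K : Type) [Field K] [NumberField K] (n : ℕ) [NeZero n],
      (Literature.NumberTheory.GaloisCohomology.LocalInvariants.canonical K n).SelmerComplement)
    (hLabT : ∀ (W : WeierstrassCurve ℚ) [W.IsElliptic] [W.IsGloballyMinimal] (p : ℕ) [Fact p.Prime],
      Summit.BirchSwinnertonDyer.Rank1Residual.ClassX11b W p → 5 ≤ p →
      ∀ (N : ℕ) [NeZero N] (K : Type) [Field K] [NumberField K] (S : Finset ℕ)
        (Dt : Literature.NumberTheory.EllipticCurves.ModularForms.ModularParametrizationData W N)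
        (X : Literature.NumberTheory.Automorphic.ShimuraCurveData (∏ q ∈ S, q) (N / ∏ q ∈ S, q)) (W' : WeierstrassCurve ℚ) [W'.IsElliptic]
        (P₀ : Literature.NumberTheory.Automorphic.ShimuraParametrizationData X W'),
        W.conductorNorm ℤ = N → Literature.NumberTheory.EllipticCurves.IsImaginaryQuadratic K → NumberField.discr K < -4 → Even S.card →
        (∀ ℓ ∈ S, ℓ.Prime ∧ ℓ ∣ N ∧ ¬ ℓ ^ 2 ∣ N ∧
          ((Ideal.span {(ℓ : ℤ)}).primesOver (NumberField.RingOfIntegers K)).ncard = 1 ∧ ¬ (ℓ : ℤ) ∣ NumberField.discr K) →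
        (∀ ℓ : ℕ, ℓ.Prime → ℓ ∣ N → ℓ ∉ S → ((Ideal.span {(ℓ : ℤ)}).primesOver (NumberField.RingOfIntegers K)).ncard = 2) →
        p ∈ S → ¬ (p : ℤ) ∣ Dt.c → P₀.IsMinimalFor W →
        ∃ (ι : K →+* ℂ) (y : (W.baseChange K).toAffine.Point) (degy : ℕ)
          (ys : (m : ℕ) → (W.baseChange (Literature.NumberTheory.EllipticCurves.ringClassField K ι m)).toAffine.Point) (ε : ℤ), 0 < degy ∧
          padicValNat p degy = padicValNat p P₀.deg ∧
          Literature.NumberTheory.EllipticCurves.LDerivEK W K = 8 * (Real.pi : ℂ) ^ 2 *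
              Literature.NumberTheory.EllipticCurves.ModularForms.peterssonProduct (CongruenceSubgroup.Gamma0 N) 2 Dt.f Dt.f /
              ((((NumberField.Units.torsionOrder K : ℝ) / 2) ^ 2 * √|(NumberField.discr K : ℝ)| : ℝ) : ℂ) *
            ((y.canonicalHeight : ℂ) / (degy : ℂ)) ∧
          (¬ IsOfFinAddOrder y → 0 < (AddSubgroup.zmultiples y).index) ∧
          Summit.BirchSwinnertonDyer.BirchSwinnertonDyer.Theorems.ShimuraWalk.LabelsAt W N K ι y ys ε ∧
          ∀ (q : ℕ) [Fact q.Prime], q ∣ N → q ∉ S → p ∣ (W.baseChange ℚ_[q]).localTamagawaNumber ℤ_[q] →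
            Literature.NumberTheory.EllipticCurves.ShimuraCMFamily.LabelB6 ι W N {q} ys)
    [Fact (Nat.Prime 5)] [((⟨0, 1, 0, -615785, 185776275⟩ : WeierstrassCurve ℤ).baseChange ℚ).IsElliptic] [((⟨0, 1, 0, -615785, 185776275⟩ : WeierstrassCurve ℤ).baseChange ℚ).IsGloballyMinimal] (hr : ((⟨0, 1, 0, -615785, 185776275⟩ : WeierstrassCurve ℤ).baseChange ℚ).analyticRank = 1) :
    Typed.MissingUpperBoundAt ((⟨0, 1, 0, -615785, 185776275⟩ : WeierstrassCurve ℤ).baseChange ℚ) 5 :=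
  EulerHalfPAnchor.eulerHalfNotRam_otherMult_of_items_of_LAB h₅ h₃ hJL hCO hCTi hESi hSC hLabT ((⟨0, 1, 0, -615785, 185776275⟩ : WeierstrassCurve ℤ).baseChange ℚ) 5
    (classX11b_five_iff_analyticRank.mpr hr) le_rfl surj_five not_ram_five exists_otherMult

/-- **THE RUNG ON THE p-ANCHOR ROAD — the text of crux 19715 `EulerHalfNotRamNoInertSetAtFive` AT THE PAIR (129360cy1, 5), VERBATIM as conclusion**, from
exactly the v13 composition's binders for piece S2 (six route items + conjunct (2) of the print stub + LAB); the text's own binders `ClassX11b`, `Surj`, `¬ Ram`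
feed the road, «a multiplicative `ℓ ≠ 5`» is the kernel theorem `exists_otherMult`, `5 ∣ ∏c` and «no inert datum» are unused (both are theorems at this pair:
`five_dvd_tamagawaProduct`, `no_inertDatum`). CONDITIONAL on the binders; a helper, not a closure of 19715; BSD(129360cy1, 5) is NOT proved by this.
[cite: PastenShimura2024, Lemma 6.15, Lemma 6.18] [cite: Cremona1997, Table 1 (curve 129360cy1)] -/
theorem rung_res_129360cy1_of_items_of_LAB_pAnchor (h₅ : PublishedInputsFive) (h₃ : X11aLowerHalf)
    (hJL : ShimuraParametrizationDataNonempty) (hCO : PastenComponentOrdersInput) (hCTi : ShimuraCasselsTateLevelInputs)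
    (hESi : ShimuraHeegnerEulerSystemInertPrintedR)
    (hSC : ∀ (K : Type) [Field K] [NumberField K] (n : ℕ) [NeZero n],
      (Literature.NumberTheory.GaloisCohomology.LocalInvariants.canonical K n).SelmerComplement)
    (hLabT : ∀ (W : WeierstrassCurve ℚ) [W.IsElliptic] [W.IsGloballyMinimal] (p : ℕ) [Fact p.Prime],
      Summit.BirchSwinnertonDyer.Rank1Residual.ClassX11b W p → 5 ≤ p →
      ∀ (N : ℕ) [NeZero N] (K : Type) [Field K] [NumberField K] (S : Finset ℕ)
        (Dt : Literature.NumberTheory.EllipticCurves.ModularForms.ModularParametrizationData W N)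
        (X : Literature.NumberTheory.Automorphic.ShimuraCurveData (∏ q ∈ S, q) (N / ∏ q ∈ S, q)) (W' : WeierstrassCurve ℚ) [W'.IsElliptic]
        (P₀ : Literature.NumberTheory.Automorphic.ShimuraParametrizationData X W'),
        W.conductorNorm ℤ = N → Literature.NumberTheory.EllipticCurves.IsImaginaryQuadratic K → NumberField.discr K < -4 → Even S.card →
        (∀ ℓ ∈ S, ℓ.Prime ∧ ℓ ∣ N ∧ ¬ ℓ ^ 2 ∣ N ∧
          ((Ideal.span {(ℓ : ℤ)}).primesOver (NumberField.RingOfIntegers K)).ncard = 1 ∧ ¬ (ℓ : ℤ) ∣ NumberField.discr K) →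
        (∀ ℓ : ℕ, ℓ.Prime → ℓ ∣ N → ℓ ∉ S → ((Ideal.span {(ℓ : ℤ)}).primesOver (NumberField.RingOfIntegers K)).ncard = 2) →
        p ∈ S → ¬ (p : ℤ) ∣ Dt.c → P₀.IsMinimalFor W →
        ∃ (ι : K →+* ℂ) (y : (W.baseChange K).toAffine.Point) (degy : ℕ)
          (ys : (m : ℕ) → (W.baseChange (Literature.NumberTheory.EllipticCurves.ringClassField K ι m)).toAffine.Point) (ε : ℤ), 0 < degy ∧
          padicValNat p degy = padicValNat p P₀.deg ∧
          Literature.NumberTheory.EllipticCurves.LDerivEK W K = 8 * (Real.pi : ℂ) ^ 2 *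
              Literature.NumberTheory.EllipticCurves.ModularForms.peterssonProduct (CongruenceSubgroup.Gamma0 N) 2 Dt.f Dt.f /
              ((((NumberField.Units.torsionOrder K : ℝ) / 2) ^ 2 * √|(NumberField.discr K : ℝ)| : ℝ) : ℂ) *
            ((y.canonicalHeight : ℂ) / (degy : ℂ)) ∧
          (¬ IsOfFinAddOrder y → 0 < (AddSubgroup.zmultiples y).index) ∧
          Summit.BirchSwinnertonDyer.BirchSwinnertonDyer.Theorems.ShimuraWalk.LabelsAt W N K ι y ys ε ∧
          ∀ (q : ℕ) [Fact q.Prime], q ∣ N → q ∉ S → p ∣ (W.baseChange ℚ_[q]).localTamagawaNumber ℤ_[q] →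
            Literature.NumberTheory.EllipticCurves.ShimuraCMFamily.LabelB6 ι W N {q} ys)
    [Fact (Nat.Prime 5)] [((⟨0, 1, 0, -615785, 185776275⟩ : WeierstrassCurve ℤ).baseChange ℚ).IsElliptic] [((⟨0, 1, 0, -615785, 185776275⟩ : WeierstrassCurve ℤ).baseChange ℚ).IsGloballyMinimal] :
    Summit.BirchSwinnertonDyer.Rank1Residual.ClassX11b ((⟨0, 1, 0, -615785, 185776275⟩ : WeierstrassCurve ℤ).baseChange ℚ) 5 → 5 ≤ 5 → Literature.NumberTheory.EllipticCurves.Rank1Residual.Surj ((⟨0, 1, 0, -615785, 185776275⟩ : WeierstrassCurve ℤ).baseChange ℚ) 5 → ¬ Literature.NumberTheory.EllipticCurves.Rank1Residual.Ram ((⟨0, 1, 0, -615785, 185776275⟩ : WeierstrassCurve ℤ).baseChange ℚ) 5 → 5 ∣ ((⟨0, 1, 0, -615785, 185776275⟩ : WeierstrassCurve ℤ).baseChange ℚ).tamagawaProduct → ¬ (∃ S : Finset ℕ, (∀ ℓ ∈ S, ∃ _ : Fact ℓ.Prime, Literature.NumberTheory.EllipticCurves.Rank1Residual.Mult ((⟨0,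 1, 0, -615785, 185776275⟩ : WeierstrassCurve ℤ).baseChange ℚ) ℓ) ∧ Even S.card ∧ 5 ∈ S ∧ (∀ (ℓ : ℕ) [Fact ℓ.Prime], ℓ ∉ S → ((⟨0, 1, 0, -615785, 185776275⟩ : WeierstrassCurve ℤ).baseChange ℚ).HasSplitMultiplicativeReductionAtPrime ℓ → ¬ 5 ∣ padicValInt ℓ ((⟨0, 1, 0, -615785, 185776275⟩ : WeierstrassCurve ℤ).baseChange ℚ).minimalDiscriminantInt) ∧ (¬ 5 ∣ padicValInt 5 ((⟨0, 1, 0, -615785, 185776275⟩ : WeierstrassCurve ℤ).baseChange ℚ).minimalDiscriminantInt ∨ ∃ R ⊆ S, S.card = 2 * R.card ∧ ∀ q ∈ R, q ≠ 2 ∧ ¬ 5 ∣ q - 1)) → Literature.NumberTheory.EllipticCurves.Rank1Residual.Typed.MissingUpperBoundAt ((⟨0, 1, 0, -615785, 185776275⟩ : WeierstrassCurve ℤ).baseChange ℚ) 5 :=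
  fun hX hp5 hsurj hnram _ _ ↦
    EulerHalfPAnchor.eulerHalfNotRam_otherMult_of_items_of_LAB h₅ h₃ hJL hCO hCTi hESi hSC hLabT ((⟨0, 1, 0, -615785, 185776275⟩ : WeierstrassCurve ℤ).baseChange ℚ) 5 hX hp5 hsurj hnram exists_otherMult

end Summit.BirchSwinnertonDyer.BirchSwinnertonDyer.Theorems.EulerHalfInertUpToOne.Rung129360cy1

end
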